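import Summits.NavierStokesRegularity.NavierStokesRegularity.Theses.SqueezeCycle
import Literature.Analysis.FluidPDE.KinematicApexWitness

/-!
# `RecurrentLiouville` (crux stmt-NavierStokesRegularity-1589): the Navier–Stokes equations are
# load-bearing; the crux is not a kinematic triviality — negative-side support (cdisprove, gen 1)

Importable lemma of the standing disprover of the crux `SqueezeCycle.RecurrentLiouville`
(= `RecurrentProfiles.RecurrentLiouville`, item stmt-NavierStokesRegularity-1589, shared), over
the landed explicit witness `Literature/Analysis/FluidPDE/KinematicApexWitness.lean`
(`ParabolicBump.apexVelocity = χ(‖x‖²/(−t))/√(−t) · e₀`: smooth on the open slab, weak gradient,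
`𝐈(ℝ³ × ℝ₋) < ⊤` with pressure `0`, rate `1/√(−t)`, backward-singular origin):

* `apex_nsRescale`, `apex_isSelfSimilar`, `apex_recurrent` — the bump is EXACTLY backward
  self-similar, hence a fixed point of the scaling flow `σ ↦ nsRescale (e^σ)` and uniformly
  recurrent in `L³_loc({t ≤ 0} × ℝ³)` with every log-scale an exact return time;
* `RecurrentLiouvilleWithoutNavierStokes` — the crux with `IsSuitableWeakSolutionOn` DROPPED
  (weak gradient, `𝐈 < ⊤`, rate, recurrence, conclusion verbatim);
* `recurrentLiouville_false_without_navierStokes` — it is FALSE (the bump, `p = 0`,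
  `G = apexGradient`, `C = 1`): every conjunct of the crux's antecedent except the equations is
  jointly satisfiable by an origin-singular field, so the crux is a genuinely DYNAMICAL statement
  and the tree's renderings of `typeIBound`, `HasTypeITimeDecay`, the recurrence clause and
  `IsBackwardSingularPoint` carry no junk making it vacuous or trivially false.

## References

* G. Koch, N. Nadirashvili, G. Seregin, V. Šverák, Acta Math. 203 (2009), §1, (1.4). [KNSS2009]
* D. Albritton, T. Barker, J. Math. Fluid Mech. 21 (2019), §1 (`A, C, D, E`, `𝐈(ω)`, singular
  points). [AlbrittonBarker2019]
-/

noncomputable section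

open MeasureTheory TopologicalSpace Set Function Filter Topology Metric
open scoped InnerProductSpace RealInnerProductSpace ENNReal NNReal
open Literature.Analysis.FluidPDE
open Summit.NavierStokesRegularity.NavierStokesRegularity.Theses

set_option linter.dupNamespace false

namespace Summit.NavierStokesRegularity.NavierStokesRegularity.Theorems.RecurrentLiouville.Negative

/-- Physical space. -/
local notation "ℝ³" => EuclideanSpace ℝ (Fin 3)

/-- The open backward slab `(-∞,0) × ℝ³` (time first), as in the route file. -/
local notation "𝕊" => Literature.Analysis.FluidPDE.slab (EuclideanSpace ℝ (Fin 3)) (Set.Iio (0 : ℝ)) isOpen_Iio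

/-- The kinematic bump is EXACTLY backward self-similar: `u_λ = u` for every `λ > 0`
(`λ χ(‖λx‖²/(−λ²t))/√(−λ²t) = χ(‖x‖²/(−t))/√(−t)`). [folklore] -/
theorem apex_nsRescale {lam : ℝ} (hlam : 0 < lam) :
    nsRescale lam ParabolicBump.apexVelocity = ParabolicBump.apexVelocity := by
  funext t x
  simp only [nsRescale_apply, ParabolicBump.apexVelocity, ParabolicBump.apexAmp, smul_smul]
  congr 1
  have h1 : Real.sqrt (-(lam ^ 2 * t)) = lam * Real.sqrt (-t) := by
    rw [show -(lam ^ 2 * t) = lam ^ 2 * (-t) by ring, Real.sqrt_mul (sq_nonneg _),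
      Real.sqrt_sq hlam.le]
  have h2 : ‖lam • x‖ ^ 2 / (-(lam ^ 2 * t)) = ‖x‖ ^ 2 / (-t) := by
    rw [norm_smul, Real.norm_of_nonneg hlam.le, mul_pow,
      show -(lam ^ 2 * t) = lam ^ 2 * (-t) by ring, mul_div_mul_left _ _ (pow_ne_zero 2 hlam.ne')]
  rw [h2, h1, mul_div_assoc', mul_div_mul_left _ _ hlam.ne']

/-- Hence a FIXED POINT of the scaling flow. [folklore] -/
theorem apex_isSelfSimilar : IsSelfSimilar ParabolicBump.apexVelocity :=
  fun _ hc => apex_nsRescale hc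

/-- The bump is uniformly recurrent under scaling in `L³_loc({t ≤ 0} × ℝ³)` — the recurrence
clause of the crux, verbatim: every log-scale is an exact return time. [folklore] -/
theorem apex_recurrent :
    ∀ ε : ℝ, 0 < ε → ∀ K : Set (ℝ × ℝ³), IsCompact K → K ⊆ Set.Iic (0 : ℝ) ×ˢ Set.univ →
      ∃ L : ℝ, 0 < L ∧ ∀ a : ℝ, ∃ σ ∈ Set.Icc a (a + L),
        MeasureTheory.eLpNorm (fun z : ℝ × ℝ³ =>
          nsRescale (Real.exp σ) ParabolicBump.apexVelocity z.1 z.2 -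
            ParabolicBump.apexVelocity z.1 z.2) 3
          (MeasureTheory.volume.restrict K) ≤ ENNReal.ofReal ε := by
  intro ε _ K _ _
  refine ⟨1, one_pos, fun a => ⟨a, ⟨le_rfl, by linarith⟩, ?_⟩⟩
  have h1 : (fun z : ℝ × ℝ³ => nsRescale (Real.exp a) ParabolicBump.apexVelocity z.1 z.2 -
      ParabolicBump.apexVelocity z.1 z.2) = 0 := by
    funext z
    rw [apex_nsRescale (Real.exp_pos a)]
    simp
  rw [h1, eLpNorm_zero]
  exact bot_le

/-- The crux `RecurrentLiouville` with `IsSuitableWeakSolutionOn 𝕊 1 0 u p` DROPPED (all other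
clauses verbatim, in the same order; `p` then only enters through `typeIBound`). -/
def RecurrentLiouvilleWithoutNavierStokes : Prop :=
  ∀ (u : ℝ → ℝ³ → ℝ³) (p : ℝ → ℝ³ → ℝ) (G : ℝ → ℝ³ → ℝ³ →L[ℝ] ℝ³) (C : ℝ),
    HasWeakSpatialGradientOn 𝕊 u G →
    typeIBound (Set.Iio (0 : ℝ) ×ˢ Set.univ) u p G < ⊤ →
    HasTypeITimeDecay C u →
    (∀ ε : ℝ, 0 < ε → ∀ K : Set (ℝ × ℝ³), IsCompact K → K ⊆ Set.Iic (0 : ℝ) ×ˢ Set.univ →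
      ∃ L : ℝ, 0 < L ∧ ∀ a : ℝ, ∃ σ ∈ Set.Icc a (a + L),
        MeasureTheory.eLpNorm (fun z : ℝ × ℝ³ => nsRescale (Real.exp σ) u z.1 z.2 - u z.1 z.2) 3
          (MeasureTheory.volume.restrict K) ≤ ENNReal.ofReal ε) →
    ¬ IsBackwardSingularPoint u 0

/-- Sanity: adding the equations back gives the crux verbatim. -/
theorem recurrentLiouville_iff_guarded_by_navierStokes :
    SqueezeCycle.RecurrentLiouville ↔
      ∀ (u : ℝ → ℝ³ → ℝ³) (p : ℝ → ℝ³ → ℝ) (G : ℝ → ℝ³ → ℝ³ →L[ℝ] ℝ³) (C : ℝ),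
        IsSuitableWeakSolutionOn 𝕊 1 0 u p → HasWeakSpatialGradientOn 𝕊 u G →
        typeIBound (Set.Iio (0 : ℝ) ×ˢ Set.univ) u p G < ⊤ →
        HasTypeITimeDecay C u →
        (∀ ε : ℝ, 0 < ε → ∀ K : Set (ℝ × ℝ³), IsCompact K → K ⊆ Set.Iic (0 : ℝ) ×ˢ Set.univ →
          ∃ L : ℝ, 0 < L ∧ ∀ a : ℝ, ∃ σ ∈ Set.Icc a (a + L),
            MeasureTheory.eLpNorm (fun z : ℝ × ℝ³ => nsRescale (Real.exp σ) u z.1 z.2 - u z.1 z.2) 3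
              (MeasureTheory.volume.restrict K) ≤ ENNReal.ofReal ε) →
        ¬ IsBackwardSingularPoint u 0 :=
  Iff.rfl

/-- **The Navier–Stokes equations are load-bearing in `RecurrentLiouville`.** With
`IsSuitableWeakSolutionOn` dropped the crux is FALSE: the kinematic bump (`p = 0`,
`G = apexGradient`, `C = 1`) has a weak gradient on the slab, `𝐈 < ⊤`, the Type-I rate, is
uniformly recurrent (a fixed point of the scaling flow) and is singular at the origin. So the
function classes of the crux are consistent with an origin singularity: the statement is
dynamical, not kinematic. [cite: AlbrittonBarker2019, §1] -/
theorem recurrentLiouville_false_without_navierStokes : ¬ RecurrentLiouvilleWithoutNavierStokes :=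
  fun h => h _ 0 _ 1 ParabolicBump.apex_hasWeakSpatialGradientOn ParabolicBump.typeIBound_apex_lt_top
    ParabolicBump.apex_hasTypeITimeDecay apex_recurrent ParabolicBump.apex_isBackwardSingularPoint

/-- Packaged: the antecedent of the crux MINUS the equations is inhabited by an origin-singular,
uniformly recurrent field with `𝐈 < ⊤` and the rate (kinematic non-vacuity of the singular side).
[cite: AlbrittonBarker2019, §1] -/
theorem classWithoutNavierStokes_singular_inhabited :
    ∃ (u : ℝ → ℝ³ → ℝ³) (p : ℝ → ℝ³ → ℝ) (G : ℝ → ℝ³ → ℝ³ →L[ℝ] ℝ³) (C : ℝ),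
      HasWeakSpatialGradientOn 𝕊 u G ∧ typeIBound (Set.Iio (0 : ℝ) ×ˢ Set.univ) u p G < ⊤ ∧
      HasTypeITimeDecay C u ∧
      (∀ ε : ℝ, 0 < ε → ∀ K : Set (ℝ × ℝ³), IsCompact K → K ⊆ Set.Iic (0 : ℝ) ×ˢ Set.univ →
        ∃ L : ℝ, 0 < L ∧ ∀ a : ℝ, ∃ σ ∈ Set.Icc a (a + L),
          MeasureTheory.eLpNorm (fun z : ℝ × ℝ³ => nsRescale (Real.exp σ) u z.1 z.2 - u z.1 z.2) 3
            (MeasureTheory.volume.restrict K) ≤ ENNReal.ofReal ε) ∧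
      IsBackwardSingularPoint u 0 :=
  ⟨_, 0, _, 1, ParabolicBump.apex_hasWeakSpatialGradientOn, ParabolicBump.typeIBound_apex_lt_top,
    ParabolicBump.apex_hasTypeITimeDecay, apex_recurrent, ParabolicBump.apex_isBackwardSingularPoint⟩

end Summit.NavierStokesRegularity.NavierStokesRegularity.Theorems.RecurrentLiouville.Negative

end
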